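import Summits.CriticalPhenomena.PercolationContinuityZ3.Theorems.Transplant.SkelPhiFaceRouteReadingsS
import Summits.CriticalPhenomena.PercolationContinuityZ3.Theorems.Transplant.SkelPhiFaceRouteReadings
import Summits.CriticalPhenomena.PercolationContinuityZ3.Theorems.Transplant.SkelPhiFaceNumsFoot
import Literature.Probability.Percolation.OrientedHistorySiteRenormalizationRun
import Summits.CriticalPhenomena.PercolationContinuityZ3.Theorems.Transplant.PlanarCells2SDefs
import HarnessLib
/-!
# N2 (frames-only node `SamePDropOfSkeletonFrm₁`, OPEN) — WAVE 1, (F) face-data column over STAGGERED cells ((R-22) `PCells2S`, (R-28)(β) one landing per file): the twin of N1's `SkelPhiFaceNumsFoot`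

builds on p205010 (kernel theorem, internal audit signed; external expert review pending) — nothing in this file uses p205010; NOTHING is claimed about the
open node `SamePDropOfSkeletonFrm₁` (`SamePDropOfSkeletonNeg₁` is CLOSED in the tree and untouched by this file).
Status sentence (coordinator 2026-08-20T04:30Z): "θ(p_c) = 0 on ℤ^d, all d ≥ 2 — kernel-verified (Lean 4/Mathlib, standard axioms); internal adversarial
audit SIGNED 2026-08-20 04:29Z; external expert review pending."
Lane `prim-bschramm`, seat `prim-hp-8` (gen 40); helper file (`--supports stmt-CriticalPhenomena-4575 --as helper`); design owner p3-g15 ((R-22) staggered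
cells `PCells2S`, (R-27)/(R-29) far regions of record `FarNS/FarNS₂`, (R-28)(β), naming 2026-08-22T23:00:04Z: suffix `S`).
PORT RULES (HOME/prim-hp-8/code/gen40/orient/bin/port_s.py = stmt-g19's port_orient.py + the G token table): the cells are `P : PCells2S`, every box is
read about the STAGGERED centre `cenS` (`PlanarCells2SDefs/SFar/ContainS/SArm/SepS/SepInfS/LevelsS/EfarN2S`), the scheme record is `cellGeomSG₂S`/`cellGeomSG₂bS`
(`SkelPhiCellsWeakGS/…SmallMS`: narrow arm `BtwNS`, two-block far region `FarNS₂`), the history-site API is the ORIENTED one at `qNE` where it occurs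
(`ochoice qNE`, `onwardO`, `Valid₂O`, `IsRun₂O`, …, (R-18)); EVERY declaration is re-declared with the suffix `S` (same namespace). Docstrings/citations are N1's.
N1 HEADER (kept for the reader):
* `PCells2.lev_cen_add_stepVec`, **`Skelφ.not_mem_MbWin_of_near`**, `Skelφ.disjoint_MbWin_of_near`.
[cite: KozmaNitzan2024, §4 p. 26 (M_v), Lemma 11 (p. 22)]
-/
noncomputable section

open scoped Classical

namespace Summit.CriticalPhenomena.PercolationContinuityZ3.Theorems.Transplant

open Literature.Probability.Percolation Literature.Probability.LatticeModels KNCells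
open Literature.Probability.Percolation.KozmaNitzan
open Literature.Probability.Percolation.KozmaNitzan.Cells (oth oth_ne sgOf sgOf_sign stepVec_apply_fst stepVec_apply_oth eq_oth_of_ne oth_oth)
open Literature.Barriers.CriticalPhenomena (graphBall)

/-- The next cube's centre sits at planar level `20·r∥`. [folklore] -/
theorem PCells2S.lev_cen_add_stepVec (P : PCells2S) (x : Site 2) (du : MDir) : P.lev du x (P.cenS (x + stepVec du)) = 20 * (P.r du.1 : ℤ) := by
  unfold PCells2S.lev
  rw [P.cenS_add_stepVec_fst]
  have hsq : sgOf du * sgOf du = 1 := by rcases sgOf_sign du with h | h <;> rw [h] <;> norm_num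
  linear_combination (20 * (P.r du.1 : ℤ)) * hsq

namespace Skelφ

variable {V : Type} [DecidableEq V] {G : SimpleGraph V} [G.LocallyFinite] {φ : V → Site 2}

/-- **THE ARRIVAL BOX IS OFF THE NEAR ZONE**: a vertex whose base-`c` cell coordinate on the face's axis is at most `k` lies outside
`VWin ψ w₀ (Mb b₀ (x + du)) R` once `lev(z_c) + k + 1 < 20·r∥ − b₀∥`. [cite: KozmaNitzan2024, §4 p. 26, Lemma 11 (p. 22)] -/
theorem not_mem_MbWin_of_nearS (P : PCells2S) (w₀ c : V) (A n h vα vβ c₀ c₁ : ℤ) {D : ℤ} (hD : 0 < D) {x : Site 2} {du : MDir} {b₀ : Fin 2 → ℕ}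
    {R : ℕ} {k Lc : ℤ} {v : V} (hk : |fineSkel φ c A n h vα vβ c₀ c₁ (D / 2) (D / 2) D v du.1| ≤ k)
    (hLc : P.lev du x (fineSkel φ w₀ A n h vα vβ c₀ c₁ (D / 2) (D / 2) D c) ≤ Lc) (hfar : Lc + k + 1 < 20 * (P.r du.1 : ℤ) - b₀ du.1) :
    v ∉ VWin G (fineSkel φ w₀ A n h vα vβ c₀ c₁ (D / 2) (D / 2) D) w₀ (P.Mb b₀ (x + stepVec du)) R := by
  intro hv
  have hW := (mem_Win G _).1 (VWin_subset_Win w₀ _ _ hv)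
  have hM := (PCells2S.mem_Mb_iff (P := P)).1 hW.2 du.1
  have hbc := abs_le.1 (abs_fineSkel_base_change (φ := φ) w₀ c v A n h vα vβ c₀ c₁ hD du.1)
  have hk' := abs_le.1 hk
  have hcen := P.lev_cen_add_stepVec x du
  unfold PCells2S.lev at hLc hcen
  have hσ := sgOf_sign du
  rcases hσ with hs | hs <;> rw [hs] at hLc hcen <;> nlinarith [hM.1, hM.2, hbc.1, hbc.2, hk'.1, hk'.2]

/-- **`hMZ`**: a finite set of near vertices (each within `k` on the face's axis) is disjoint from the arrival box. [folklore] -/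
theorem disjoint_MbWin_of_nearS (P : PCells2S) (w₀ c : V) (A n h vα vβ c₀ c₁ : ℤ) {D : ℤ} (hD : 0 < D) {x : Site 2} {du : MDir}
    {b₀ : Fin 2 → ℕ} {R : ℕ} {k Lc : ℤ} {Z : Finset V} (hk : ∀ v ∈ Z, |fineSkel φ c A n h vα vβ c₀ c₁ (D / 2) (D / 2) D v du.1| ≤ k)
    (hLc : P.lev du x (fineSkel φ w₀ A n h vα vβ c₀ c₁ (D / 2) (D / 2) D c) ≤ Lc) (hfar : Lc + k + 1 < 20 * (P.r du.1 : ℤ) - b₀ du.1) :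
    Disjoint (VWin G (fineSkel φ w₀ A n h vα vβ c₀ c₁ (D / 2) (D / 2) D) w₀ (P.Mb b₀ (x + stepVec du)) R) Z :=
  Finset.disjoint_right.2 fun v hv => not_mem_MbWin_of_nearS P w₀ c A n h vα vβ c₀ c₁ hD (hk v hv) hLc hfar

end Skelφ

end Summit.CriticalPhenomena.PercolationContinuityZ3.Theorems.Transplant

end
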